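import Literature.AlgebraicGeometry.Smoothening.WeakNeronModelSmooth
import Literature.AlgebraicGeometry.Motives.AbelianVarietyProjectiveChart
import Literature.AlgebraicGeometry.Motives.AbelianVarietyProofs
import HarnessLib

/-!
# Weak Néron models of abelian varieties over a discrete valuation ring (BLR 3.5 with 1.4)

Topic: `Literature/AlgebraicGeometry/Smoothening` (Bosch–Lütkebohmert–Raynaud, *Néron Models*,
§3.5 (weak Néron models of proper smooth `K`-schemes) for abelian varieties, the input of
Chapters 4–6 towards Cor. 1.3/2; M. Artin, *Néron Models*, Lemma (3.6)). An abelian variety `E`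
over the fraction field `K` of a discrete valuation ring `R` is projective (the tree's
`Motives.AbelianVariety.isProjectiveOver_holds`, Mumford §6–7 / Görtz–Wedhorn II 27.174), smooth
(`Motives.AbelianVariety.smooth_hom`) and integral; so it has a projective model
(`nonempty_projectiveModel`) all of whose affine charts admit smoothenings when the residue
field is perfect (`ProjectiveModel.nonempty_smoothening_chart`), with the weak Néron property
(`ProjectiveModel.exists_smooth_lift_of_point`), and hence finitely many smooth affine charts with
the weak Néron property (`ProjectiveModel.nonempty_smoothCharts`,
`ProjectiveModel.exists_smoothChart_lift_of_point`). This file records the specialisations for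
the hypotheses of `Literature.NumberTheory.EllipticCurves.exists_isNeronModel` (a group scheme
`E → Spec K` which is proper and geometrically integral). [folklore]; no named facts (D-0026).

## References

* S. Bosch, W. Lütkebohmert, M. Raynaud, *Néron Models*, Springer 1990, §3.5, §1.3–1.4.
  [BLRNeronModels1990] (Not held; numbers only.)
* M. Artin, *Néron Models*, in Cornell–Silverman (eds.), *Arithmetic Geometry*, Springer 1986,
  Lemma (3.6) (p. 225). [Artin1986NeronModels]
-/

noncomputable section

open CategoryTheory AlgebraicGeometry IsLocalRing
open Literature.AlgebraicGeometry.Motives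

namespace Literature.AlgebraicGeometry.Smoothening

universe u

variable (R K : Type u) [CommRing R] [IsDomain R] [IsDiscreteValuationRing R] [Field K] [Algebra R K]
  [IsFractionRing R K] (E : Over (Spec (.of K))) [GrpObj E] [IsProper E.hom] [GeometricallyIntegral E.hom]

/-- An abelian variety in the sense of `exists_isNeronModel` (a proper geometrically integral
group scheme over `K`) is a `Motives.AbelianVariety`. [folklore] -/
abbrev toAbelianVariety : AbelianVariety K := AbelianVariety.mk E ‹_› ‹_›

omit [IsDomain R] [IsDiscreteValuationRing R] in
/-- **Abelian varieties have projective models over a domain with fraction field `K`** (they are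
projective, `Motives.AbelianVariety.isProjectiveOver_holds`). [folklore] -/
theorem nonempty_projectiveModel_of_grpObj : Nonempty (ProjectiveModel R K E) :=
  nonempty_projectiveModel R K E (AbelianVariety.isProjectiveOver_holds (toAbelianVariety K E))

/-- **Weak Néron models of abelian varieties** (BLR 3.5; Artin, Lemma (3.6)): over a discrete
valuation ring `R` with uniformizer `ϖ` and perfect residue field, every abelian variety `E` over
`K = Frac R` has a projective model `M` whose affine charts all admit smoothenings `𝒮 s`; and for
any such data every `L`-valued point of `E` (`L = Frac S`, `S` a discrete valuation ring over `R`
in which `ϖ` is a uniformizer) extends to an `S`-valued point of one of the finitely many charts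
`X_{s,i}` of the `𝒮 s` at which `X_{s,i}` is smooth over `R`. [cite: Artin1986NeronModels, Lemma (3.6) (p. 225)] -/
theorem exists_weakNeronCharts [PerfectField (ResidueField R)] {ϖ : R} (hϖ : Irreducible ϖ) :
    ∃ M : ProjectiveModel R K E, (∀ s, Nonempty (NeronSmoothening R ϖ (M.chartIdeal s) ⊥)) ∧
      ∀ (𝒮 : ∀ s : Fin (M.n + 1), NeronSmoothening R ϖ (M.chartIdeal s) ⊥)
        (S L : Type u) [CommRing S] [IsDomain S] [IsDiscreteValuationRing S] [Field L] [Algebra S L]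
        [IsFractionRing S L] [Algebra R S] [Algebra K L] [Algebra R L] [IsScalarTower R S L]
        [IsScalarTower R K L], Irreducible (algebraMap R S ϖ) →
        ∀ (x : Spec (.of L) ⟶ E.left), x ≫ E.hom = Spec.map (CommRingCat.ofHom (algebraMap K L)) →
          ∃ (s : Fin (M.n + 1)) (i : (𝒮 s).ι)
            (a' : (MvPolynomial (Fin ((𝒮 s).N' i)) R ⧸ (𝒮 s).I' i) →ₐ[R] S),
            Spec.map (CommRingCat.ofHom (algebraMap S L)) ≫
                Spec.map (CommRingCat.ofHom (a'.comp ((𝒮 s).path i).map).toRingHom) ≫ M.chart s =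
                  x ≫ M.gen ∧
              neronDefectOfHom R S a' = 0 ∧
              Algebra.IsSmoothAt R ((maximalIdeal S).comap a'.toRingHom) := by
  obtain ⟨M⟩ := nonempty_projectiveModel_of_grpObj R K E
  haveI : Smooth E.hom := AbelianVariety.smooth_hom (toAbelianVariety K E)
  haveI : IsIntegral E.left := GeometricallyIntegral.isIntegral_of_subsingleton E.hom
  exact ⟨M, fun s => M.nonempty_smoothening_chart hϖ s, fun 𝒮 S L _ _ _ _ _ _ _ _ _ _ _ hπ x hx =>
    M.exists_smooth_lift_of_point hϖ 𝒮 hπ x hx⟩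

/-- **Weak Néron models of abelian varieties, as finitely many smooth affine `R`-schemes**
(BLR 3.5; Artin, Lemma (3.6) with "we may assume `V` smooth"): over a discrete valuation ring `R`
with uniformizer `ϖ` and perfect residue field, every abelian variety `E` over `K = Frac R` has a
projective model `M` whose affine charts all admit smooth charts `𝒞 s` (`SmoothCharts`: finitely
many smooth `R`-algebras `R[T]/J` reached by paths of open immersions and dilatations), and for
any such data every `L`-valued point of `E` (`L = Frac S`, `S` a discrete valuation ring over `R`
in which `ϖ` is a uniformizer) extends to an `S`-valued point of one of them.
[cite: Artin1986NeronModels, Lemma (3.6) (p. 225)] -/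
theorem exists_smoothWeakNeronCharts [PerfectField (ResidueField R)] {ϖ : R} (hϖ : Irreducible ϖ) :
    ∃ M : ProjectiveModel R K E, (∀ s, Nonempty (SmoothCharts R ϖ (M.chartIdeal s))) ∧
      ∀ (𝒞 : ∀ s : Fin (M.n + 1), SmoothCharts R ϖ (M.chartIdeal s))
        (S L : Type u) [CommRing S] [IsDomain S] [IsDiscreteValuationRing S] [Field L] [Algebra S L]
        [IsFractionRing S L] [Algebra R S] [Algebra K L] [Algebra R L] [IsScalarTower R S L]
        [IsScalarTower R K L], Irreducible (algebraMap R S ϖ) →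
        ∀ (x : Spec (.of L) ⟶ E.left), x ≫ E.hom = Spec.map (CommRingCat.ofHom (algebraMap K L)) →
          ∃ (s : Fin (M.n + 1)) (j : (𝒞 s).ι)
            (b : (MvPolynomial (Fin ((𝒞 s).N' j)) R ⧸ (𝒞 s).I' j) →ₐ[R] S),
            Spec.map (CommRingCat.ofHom (algebraMap S L)) ≫
                Spec.map (CommRingCat.ofHom (b.comp ((𝒞 s).path j).map).toRingHom) ≫ M.chart s =
                  x ≫ M.gen := by
  obtain ⟨M⟩ := nonempty_projectiveModel_of_grpObj R K E
  haveI : Smooth E.hom := AbelianVariety.smooth_hom (toAbelianVariety K E)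
  haveI : IsIntegral E.left := GeometricallyIntegral.isIntegral_of_subsingleton E.hom
  exact ⟨M, fun s => M.nonempty_smoothCharts hϖ s, fun 𝒞 S L _ _ _ _ _ _ _ _ _ _ _ hπ x hx =>
    M.exists_smoothChart_lift_of_point 𝒞 hπ x hx⟩

end Literature.AlgebraicGeometry.Smoothening

end
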